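import Literature.Probability.Percolation.FiniteEnergy
import Literature.Probability.Percolation.PercolationProofs
import HarnessLib

/-!
# Separated chaining is free: relays with disjoint edge resources

Solo-blind generation 6, `PercolationContinuityZ3` (target `θ(p_c) = 0` on `ℤ³`); companion to
`SoloBlindChainingBound.lean`.

Kozma–Nitzan (arXiv:2401.12397) reduce `θ(p_c) = 0` to their Conjecture 3: on any finite graph,
`P(o ↔ A) > 1 - δ` and `P(a ↔ b) > 1 - δ` for all `a ∈ A` should force `P(o ↔ b) > 1 - ε`,
uniformly in the graph. They remark (Lemma 10, p. 17) that their use of it would be easy if the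
target lay INSIDE the frozen shell. This file is the graph-general, kernel-checked form of that
remark. Call an instance SEPARATED when there are DISJOINT edge sets `E_o`, `E_b` such that
`o` reaches the relay set `A` using only edges of `E_o` (with probability `≥ 1 - δ₁`) and every
relay `a ∈ A` reaches `b` using only edges of `E_b` (with probability `≥ 1 - δ`). Then, for
Bernoulli bond percolation at any density on any simple graph with countably many vertices,

  `P(o ↔ b) ≥ (1 - δ₁)(1 - δ)`  (`separated_chaining`), hence `≥ 1 - δ₁ - δ`
  (`separated_chaining_sub`),

with NO condition on the number of relays: reveal the `E_o`-edges, pick the first relay reached,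
and use the independent `E_b`-connection of that relay. The abstract engine is
`indep_biUnion_inter_lower`: if `σ`-algebras `m₁`, `m₂` are independent, `U i ∈ m₁`, `W i ∈ m₂`
and `P(W i) ≥ 1 - δ`, then `P(⋃_{i ∈ s} (U i ∩ W i)) ≥ (1 - δ) P(⋃_{i ∈ s} U i)` (induction on `s`
with the disjointification `U i \ U a`).

Reading (wall document of this seat, §10): together with `SoloBlindChainingBound.lean` (the
conclusion of Conjecture 3 is free when `δ · E|C(o) ∩ A|` is small) this pins the content of the
Kozma–Nitzan conjecture to the conjunction MANY CONTACTS ∧ SHARED EDGES — in their Lemma 10 the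
paths from `o` and the paths from the shell classes to the target both use the fresh edges outside
the frozen shell, and the cluster of `o` meets many classes.

References: G. Kozma, S. Nitzan, arXiv:2401.12397 (2024), Conjecture 3 and Lemma 10 (context);
independence of disjoint edge sets: Grimmett, Percolation (1999), §2.2, via the tree's
`bondPercolation_indep_edgeSigma`.
-/

namespace Summit.CriticalPhenomena.PercolationContinuityZ3.Theorems

open MeasureTheory ProbabilityTheory Literature.Probability.Percolation

/-! ### Abstract engine: an independent high-probability "rescue" of each piece of a union -/

section Abstract

variable {Ω ι : Type*} {m₁ m₂ : MeasurableSpace Ω} {mΩ : MeasurableSpace Ω} {μ : Measure Ω}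
  [IsFiniteMeasure μ]

/-- **Independent rescue of a finite union.** Let the `σ`-algebras `m₁`, `m₂` be independent
under the finite measure `μ`, let `U i` be `m₁`-measurable and `W i` be `m₂`-measurable with
`μ(W i) ≥ 1 - δ` for `i ∈ s`. Then `(1 - δ) · μ(⋃_{i ∈ s} U i) ≤ μ(⋃_{i ∈ s} (U i ∩ W i))`.
Proof: induction on `s`; for `insert a s` split `⋃ U` into `U a` and the `m₁`-measurable pieces
`U i \ U a`, use `μ(U a ∩ W a) = μ(U a) μ(W a)` and the induction hypothesis for the pieces. -/
theorem indep_biUnion_inter_lower (h₁ : m₁ ≤ mΩ) (h₂ : m₂ ≤ mΩ) (hind : Indep m₁ m₂ μ)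
    {δ : ℝ} (W : ι → Set Ω) (hW : ∀ i, MeasurableSet[m₂] (W i)) (s : Finset ι) :
    ∀ U : ι → Set Ω, (∀ i ∈ s, MeasurableSet[m₁] (U i)) → (∀ i ∈ s, 1 - δ ≤ μ.real (W i)) →
      (1 - δ) * μ.real (⋃ i ∈ s, U i) ≤ μ.real (⋃ i ∈ s, (U i ∩ W i)) := by
  classical
  induction s using Finset.induction with
  | empty =>
    intro U _ _
    simp
  | insert a s ha ih =>
    intro U hU hWδ
    have hUa1 : MeasurableSet[m₁] (U a) := hU a (Finset.mem_insert_self a s)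
    -- the disjointified pieces
    set U' : ι → Set Ω := fun i => U i ∩ (U a)ᶜ with hU'
    have hU'm : ∀ i ∈ s, MeasurableSet[m₁] (U' i) := fun i hi =>
      (hU i (Finset.mem_insert_of_mem hi)).inter hUa1.compl
    have hIH := ih U' hU'm fun i hi => hWδ i (Finset.mem_insert_of_mem hi)
    -- ambient measurability
    have hUa : MeasurableSet[mΩ] (U a) := h₁ _ hUa1
    have hWa : MeasurableSet[mΩ] (W a) := h₂ _ (hW a)
    have hU'Ω : ∀ i ∈ s, MeasurableSet[mΩ] (U' i) := fun i hi => h₁ _ (hU'm i hi)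
    have hUW'Ω : MeasurableSet[mΩ] (⋃ i ∈ s, (U' i ∩ W i)) :=
      Finset.measurableSet_biUnion s fun i hi => (hU'Ω i hi).inter (h₂ _ (hW i))
    -- the product formula for the new piece
    have hprod : μ.real (U a ∩ W a) = μ.real (U a) * μ.real (W a) := by
      simp only [measureReal_def]
      rw [(Indep_iff _ _ _).1 hind _ _ hUa1 (hW a), ENNReal.toReal_mul]
    have h1 : (1 - δ) * μ.real (U a) ≤ μ.real (U a ∩ W a) := by
      rw [hprod]
      have hWδa := hWδ a (Finset.mem_insert_self a s)
      nlinarith [measureReal_nonneg (μ := μ) (s := U a)]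
    -- `⋃_{insert a s} U = U a ⊔ ⋃_{s} U'`
    have hsplitU : μ.real (⋃ i ∈ insert a s, U i) =
        μ.real (U a) + μ.real (⋃ i ∈ s, U' i) := by
      have hset : (⋃ i ∈ insert a s, U i) = U a ∪ ⋃ i ∈ s, U' i := by
        ext ω
        simp only [Finset.set_biUnion_insert, Set.mem_union, Set.mem_iUnion, hU',
          Set.mem_inter_iff, Set.mem_compl_iff]
        constructor
        · rintro (h | ⟨i, hi, h⟩)
          · exact Or.inl h
          · by_cases hωa : ω ∈ U a
            · exact Or.inl hωa
            · exact Or.inr ⟨i, hi, h, hωa⟩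
        · rintro (h | ⟨i, hi, h, _⟩)
          · exact Or.inl h
          · exact Or.inr ⟨i, hi, h⟩
      have hdisj : Disjoint (U a) (⋃ i ∈ s, U' i) := by
        rw [Set.disjoint_iUnion₂_right]
        intro i _
        exact Set.disjoint_left.2 fun ω hω hω' => hω'.2 hω
      rw [hset, measureReal_union hdisj (Finset.measurableSet_biUnion s hU'Ω) (measure_ne_top _ _)
        (measure_ne_top _ _)]
    -- the two rescued pieces are disjoint and sit inside the target union
    have hsub : (U a ∩ W a) ∪ (⋃ i ∈ s, (U' i ∩ W i)) ⊆ ⋃ i ∈ insert a s, (U i ∩ W i) := by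
      intro ω hω
      rw [Finset.set_biUnion_insert]
      rcases hω with h | h
      · exact Or.inl h
      · refine Or.inr ?_
        simp only [Set.mem_iUnion] at h ⊢
        obtain ⟨i, hi, hUi, hWi⟩ := h
        exact ⟨i, hi, hUi.1, hWi⟩
    have hdisj2 : Disjoint (U a ∩ W a) (⋃ i ∈ s, (U' i ∩ W i)) := by
      rw [Set.disjoint_iUnion₂_right]
      intro i _
      exact Set.disjoint_left.2 fun ω hω hω' => hω'.1.2 hω.1
    calc (1 - δ) * μ.real (⋃ i ∈ insert a s, U i)
        = (1 - δ) * μ.real (U a) + (1 - δ) * μ.real (⋃ i ∈ s, U' i) := by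
          rw [hsplitU]; ring
      _ ≤ μ.real (U a ∩ W a) + μ.real (⋃ i ∈ s, (U' i ∩ W i)) := add_le_add h1 hIH
      _ = μ.real ((U a ∩ W a) ∪ ⋃ i ∈ s, (U' i ∩ W i)) :=
          (measureReal_union hdisj2 hUW'Ω (measure_ne_top _ _) (measure_ne_top _ _)).symm
      _ ≤ μ.real (⋃ i ∈ insert a s, (U i ∩ W i)) := measureReal_mono hsub (measure_ne_top _ _)

end Abstract

/-! ### Bernoulli bond percolation: chaining across disjoint edge resources -/

section Bond

variable {V : Type*} [Countable V]

/-- The event "`x ↔ y` using only open edges of `E`", i.e. `{ω | ω ∩ E ∈ {x ↔ y}}`, is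
`σ(E)`-measurable. -/
theorem measurableSet_edgeSigma_restrict_openConn (E : Set (Sym2 V)) (x y : V) :
    MeasurableSet[edgeSigma E] ((fun ω : BondConfig V => ω ∩ E) ⁻¹' openConn x y) :=
  measurable_inter_edgeSigma E (measurableSet_openConn_holds x y)

omit [Countable V] in
/-- A connection using only open edges of `E` is a connection. -/
theorem restrict_openConn_subset (E : Set (Sym2 V)) (x y : V) :
    (fun ω : BondConfig V => ω ∩ E) ⁻¹' openConn x y ⊆ openConn x y :=
  fun ω hω => isUpperSet_openConn x y (Set.inter_subset_left : ω ∩ E ⊆ ω) hω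

/-- **Separated chaining is free.** Bernoulli bond percolation `P_p` on any simple graph with
countably many vertices; `E_o`, `E_b` DISJOINT sets of edges; `o`, `b` vertices; `A` a finite relay
set. If `o` is joined to some `a ∈ A` by open edges of `E_o` with probability `≥ 1 - δ₁`, and every
`a ∈ A` is joined to `b` by open edges of `E_b` with probability `≥ 1 - δ` (`δ ≤ 1`), then
`P_p(o ↔ b) ≥ (1 - δ₁)(1 - δ)` — whatever the size of `A`. (Independence of `σ(E_o)` and `σ(E_b)`
plus `indep_biUnion_inter_lower`; the Kozma–Nitzan "easy case", Lemma 10 p. 17 of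
arXiv:2401.12397, in graph-general form.) -/
theorem separated_chaining (G : SimpleGraph V) (p : unitInterval) {Eo Eb : Set (Sym2 V)}
    (hE : Disjoint Eo Eb) (o b : V) (A : Finset V) {δ₁ δ : ℝ} (hδ1 : δ ≤ 1)
    (hA : 1 - δ₁ ≤ (bondPercolation G p).real
      (⋃ a ∈ A, (fun ω : BondConfig V => ω ∩ Eo) ⁻¹' openConn o a))
    (hδ : ∀ a ∈ A, 1 - δ ≤ (bondPercolation G p).real
      ((fun ω : BondConfig V => ω ∩ Eb) ⁻¹' openConn a b)) :
    (1 - δ₁) * (1 - δ) ≤ (bondPercolation G p).real (openConn o b) := by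
  set U : V → Set (BondConfig V) := fun a => (fun ω : BondConfig V => ω ∩ Eo) ⁻¹' openConn o a
    with hUdef
  set W : V → Set (BondConfig V) := fun a => (fun ω : BondConfig V => ω ∩ Eb) ⁻¹' openConn a b
    with hWdef
  have hind : Indep (edgeSigma Eo) (edgeSigma Eb) (bondPercolation G p) :=
    bondPercolation_indep_edgeSigma G p hE
  have key := indep_biUnion_inter_lower (μ := bondPercolation G p) (edgeSigma_le Eo)
    (edgeSigma_le Eb) hind W (fun a => measurableSet_edgeSigma_restrict_openConn Eb a b) A U
    (fun a _ => measurableSet_edgeSigma_restrict_openConn Eo o a) hδ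
  have hsub : (⋃ a ∈ A, (U a ∩ W a)) ⊆ openConn o b := by
    intro ω hω
    simp only [Set.mem_iUnion] at hω
    obtain ⟨a, _, hUa, hWa⟩ := hω
    exact SimpleGraph.Reachable.trans (restrict_openConn_subset Eo o a hUa)
      (restrict_openConn_subset Eb a b hWa)
  calc (1 - δ₁) * (1 - δ)
      ≤ (bondPercolation G p).real (⋃ a ∈ A, U a) * (1 - δ) :=
        mul_le_mul_of_nonneg_right hA (sub_nonneg.2 hδ1)
    _ = (1 - δ) * (bondPercolation G p).real (⋃ a ∈ A, U a) := mul_comm _ _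
    _ ≤ (bondPercolation G p).real (⋃ a ∈ A, (U a ∩ W a)) := key
    _ ≤ (bondPercolation G p).real (openConn o b) := measureReal_mono hsub (measure_ne_top _ _)

/-- **Separated chaining, additive form.** Under the hypotheses of `separated_chaining` with
`0 ≤ δ ≤ 1`: `P_p(o ↔ b) ≥ 1 - δ₁ - δ`. In Kozma–Nitzan terms: a separated instance of their
Conjecture 3 holds with `ε = δ₁ + δ`, with no dependence on the graph or on `|A|`. -/
theorem separated_chaining_sub (G : SimpleGraph V) (p : unitInterval) {Eo Eb : Set (Sym2 V)}
    (hE : Disjoint Eo Eb) (o b : V) (A : Finset V) {δ₁ δ : ℝ} (hδ0 : 0 ≤ δ) (hδ1 : δ ≤ 1)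
    (hA : 1 - δ₁ ≤ (bondPercolation G p).real
      (⋃ a ∈ A, (fun ω : BondConfig V => ω ∩ Eo) ⁻¹' openConn o a))
    (hδ : ∀ a ∈ A, 1 - δ ≤ (bondPercolation G p).real
      ((fun ω : BondConfig V => ω ∩ Eb) ⁻¹' openConn a b)) :
    1 - δ₁ - δ ≤ (bondPercolation G p).real (openConn o b) := by
  have h := separated_chaining G p hE o b A hδ1 hA hδ
  have hδ₁ : 0 ≤ δ₁ := by
    have : (bondPercolation G p).real
        (⋃ a ∈ A, (fun ω : BondConfig V => ω ∩ Eo) ⁻¹' openConn o a) ≤ 1 := measureReal_le_one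
    linarith
  nlinarith

end Bond

end Summit.CriticalPhenomena.PercolationContinuityZ3.Theorems
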